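import Literature.NumberTheory.CubicFields.CubicFieldDiscriminant307ClassNumber
import Literature.NumberTheory.NumberFields.CubicFieldDedekindKummer
import Literature.NumberTheory.NumberFields.IntegralBasisIndexTwo
import HarnessLib

/-!
# The cubic field of discriminant `−2071`: `F = ℚ(θ)`, `θ³ − 5X² − 6X − 8 = 0`, `𝓞_F = ℤ ⊕ ℤθ ⊕ ℤδ`, `δ = (θ² + θ)/2`
# — a DEDEKIND-TYPE field (`2` splits completely, common index divisor `2`: NO power integral basis), `d_F = −2071` (19·109), signature `(1, 1)` — PROVED

Topic `Literature/NumberTheory/CubicFields`, namespace `Literature.NumberTheory.CubicFields.CubicDisc2071`.  THEOREMS ONLY (no definition, no named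
fact, no instance, no notation); every statement is PROVED.  Written by the prover seat `bsd-line-att-p4` g46 (cell `bsd-f1-sign2`) on the index-two
template of `CubicFieldDiscriminant431.lean` (this seat): a cubic `2`-torsion field of the SPLIT stratum (`Δ_min ≡ 1 (mod 8)`) of route `AlignedTransportAtTwo`,
in which `2 = 𝔭_a 𝔭_b 𝔭_c` splits completely, so `2` divides the index of EVERY generator (Dedekind) and `𝓞_F` is presented as `ℤ ⊕ ℤθ ⊕ ℤδ` with
`f(θ) = 0`, `f = X³ − 5X² − 6X − 8`, `Δ(f) = 2²·(−2071)`, `δ = (θ² + θ)/2` (index exactly `2`, `IntegralBasisIndexTwo`).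

## Source

[LMFDB] The L-functions and Modular Forms Database, number field `3.1.2071.1` (degree `3`, signature `[1, 1]`, discriminant `−2071`, class number `1`).
D. A. Marcus, *Number Fields*, 2nd ed. (2018) [Marcus2018], Ch. 2 Ex. 27, Ch. 3 Thm. 27 and Ex. 21 (Dedekind's common index divisor), Ch. 5 Thm. 37 and Cor. 2.

## Carrier

`F` is ANY number field with `[F : ℚ] = 3` containing `α` with `aeval α (MonicCubic.poly -5 -6 -8) = 0`; `θ := MonicCubic.thetaInt hα ∈ 𝓞 F` and
`δ := MonicCubic.thetaInt (delta_root hα) ∈ 𝓞 F` (the algebraic integer `(α² + α)/2`).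

## What is formalised (all PROVED)

* §1 the polynomials: `disc_eq`, `squarefree_neg_2071`, `irreducible_polyQ` (no root mod `5`); `delta_root`, `disc_delta_eq`, `irreducible_polyQ_delta`; the
  factorisations of `f` modulo the odd primes `≤ 12` that are not inert.
* §2 the order: `mem2` (`2·𝓞_F ⊆ ℤ[θ]`), `not_dvd_exponent` (`p ≠ 2`), `den_delta` / `mul_table`, ★ `discr_eq` (**`d_F = −2071`**, index exactly `2`),
  `nrComplexPlaces_eq_one`.
* The sequel `…2071ClassNumber.lean`: the primes of norm `≤ 12` are principal (`2` = unit × three prime elements `-16 − θ + δ`, `-85 − 76θ + 25δ`, `-23 − 25θ + 8δ`) and ★ `h_F = 1`.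

## References
* [LMFDB] The LMFDB Collaboration, The L-functions and Modular Forms Database, number field 3.1.2071.1.
* [Marcus2018] D. A. Marcus, *Number Fields*, 2nd ed., Universitext, Springer 2018, Ch. 2 Ex. 27, Ch. 3 Thm. 27 and Ex. 21, Ch. 5 Thm. 37.
-/

noncomputable section

open Polynomial NumberField NumberField.InfinitePlace Ideal Module Real
open Literature.NumberTheory.NumberFields
open Literature.NumberTheory.NumberFields.MonicCubic

namespace Literature.NumberTheory.CubicFields.CubicDisc2071

/-! ## §1 The polynomials `f = MonicCubic.poly (-5) (-6) (-8)` (index `2`) and `g = MonicCubic.poly (-21) (-26) (-8)` (index `2`) -/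

/-- `Δ(f) = -8284 = 2²·(−2071)`. [cite: LMFDB, number field 3.1.2071.1 (discriminant −2071)] [cite: Marcus2018, Ch. 2, Exercise 27] -/
theorem disc_eq : disc (-5) (-6) (-8) = 2 ^ 2 * (-2071) := by
  norm_num [disc]

/-- `−2071` is squarefree (`2071 = 19·109`). [cite: Marcus2018, Ch. 2, Exercise 27(e)] -/
theorem squarefree_neg_2071 : Squarefree (-2071 : ℤ) := by
  rw [← Int.squarefree_natAbs, show (-2071 : ℤ).natAbs = 2071 by norm_num]
  rw [show (2071 : ℕ) = 19 * 109 by norm_num, Nat.squarefree_mul_iff]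
  exact ⟨by norm_num, (by norm_num : Nat.Prime 19).squarefree, (by norm_num : Nat.Prime 109).squarefree⟩

/-- `f` has no root modulo `5`. [cite: Marcus2018, Ch. 3, Thm. 27] -/
theorem no_root_5 :
    ∀ r : ZMod 5, r ^ 3 + ((-5 : ℤ) : ZMod 5) * r ^ 2 + ((-6 : ℤ) : ZMod 5) * r + ((-8 : ℤ) : ZMod 5) ≠ 0 := by
  decide

/-- **`f` is irreducible over `ℚ`** (no root modulo `5`). [cite: LMFDB, number field 3.1.2071.1 (degree 3)] -/
theorem irreducible_polyQ : Irreducible (polyQ (-5) (-6) (-8)) :=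
  haveI : Fact (Nat.Prime 5) := ⟨by norm_num⟩
  irreducible_polyQ_of_no_root 5 no_root_5

/-- `f mod p` written out. [cite: Marcus2018, Ch. 3, Thm. 27] -/
theorem polyMod_eq (p : ℕ) : polyMod (-5) (-6) (-8) p = ((-8) + (-6) * X + (-5) * X ^ 2 + X ^ 3 : (ZMod p)[X]) := by
  simp [polyMod, poly]; ring

/-- `g mod p` written out. [cite: Marcus2018, Ch. 3, Thm. 27] -/
theorem polyModDelta_eq (p : ℕ) : polyMod (-21) (-26) (-8) p = ((-8) + (-26) * X + (-21) * X ^ 2 + X ^ 3 : (ZMod p)[X]) := by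
  simp [polyMod, poly]; ring

/-- The factorisation of `f` modulo `3`. [cite: Marcus2018, Ch. 3, Thm. 27] -/
theorem polyMod_3 : polyMod (-5) (-6) (-8) 3 = (X + 2) * (X ^ 2 + 2 * X + 2) := by
  rw [polyMod_eq]
  have hp : (3 : (ZMod 3)[X]) = 0 := by
    rw [show (3 : (ZMod 3)[X]) = C 3 from (map_natCast C 3).symm, show (3 : ZMod 3) = 0 from rfl, C_0]
  linear_combination ((-4) + (-4) * X + (-3) * X ^ 2 : (ZMod 3)[X]) * hp
/-- The quadratic factor modulo `3` is irreducible (no root). [cite: Marcus2018, Ch. 3, Thm. 27] -/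
theorem irreducible_quad_3 : Irreducible (X ^ 2 + 2 * X + 2 : (ZMod 3)[X]) := by
  have hnr : ∀ x : ZMod 3, x ^ 2 + 2 * x + 2 ≠ 0 := by decide
  haveI : Fact (Nat.Prime 3) := ⟨by norm_num⟩
  have hdeg : (X ^ 2 + 2 * X + 2 : (ZMod 3)[X]).natDegree = 2 := by compute_degree!
  refine irreducible_of_degree_le_three_of_not_isRoot (by rw [hdeg]; decide) fun x hx => hnr x ?_
  simpa only [IsRoot.def, eval_add, eval_mul, eval_pow, eval_X, eval_ofNat] using hx
/-- The factorisation of `f` modulo `11`. [cite: Marcus2018, Ch. 3, Thm. 27] -/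
theorem polyMod_11 : polyMod (-5) (-6) (-8) 11 = (X + 8) * (X ^ 2 + 9 * X + 10) := by
  rw [polyMod_eq]
  have hp : (11 : (ZMod 11)[X]) = 0 := by
    rw [show (11 : (ZMod 11)[X]) = C 11 from (map_natCast C 11).symm, show (11 : ZMod 11) = 0 from rfl, C_0]
  linear_combination ((-8) + (-8) * X + (-2) * X ^ 2 : (ZMod 11)[X]) * hp
/-- The quadratic factor modulo `11` is irreducible (no root). [cite: Marcus2018, Ch. 3, Thm. 27] -/
theorem irreducible_quad_11 : Irreducible (X ^ 2 + 9 * X + 10 : (ZMod 11)[X]) := by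
  have hnr : ∀ x : ZMod 11, x ^ 2 + 9 * x + 10 ≠ 0 := by decide
  haveI : Fact (Nat.Prime 11) := ⟨by norm_num⟩
  have hdeg : (X ^ 2 + 9 * X + 10 : (ZMod 11)[X]).natDegree = 2 := by compute_degree!
  refine irreducible_of_degree_le_three_of_not_isRoot (by rw [hdeg]; decide) fun x hx => hnr x ?_
  simpa only [IsRoot.def, eval_add, eval_mul, eval_pow, eval_X, eval_ofNat] using hx
/-- `Δ(g) = -8284 = 2²·(−2071)`. [cite: Marcus2018, Ch. 2, Exercise 27] -/
theorem disc_delta_eq : disc (-21) (-26) (-8) = 2 ^ 2 * (-2071) := by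
  norm_num [disc]

/-- `g` has no root modulo `5`. [cite: Marcus2018, Ch. 3, Thm. 27] -/
theorem no_root_5_delta :
    ∀ r : ZMod 5, r ^ 3 + ((-21 : ℤ) : ZMod 5) * r ^ 2 + ((-26 : ℤ) : ZMod 5) * r + ((-8 : ℤ) : ZMod 5) ≠ 0 := by
  decide

/-- `g` is irreducible over `ℚ`. [cite: Marcus2018, Ch. 3, Thm. 27] -/
theorem irreducible_polyQ_delta : Irreducible (polyQ (-21) (-26) (-8)) :=
  haveI : Fact (Nat.Prime 5) := ⟨by norm_num⟩
  irreducible_polyQ_of_no_root 5 no_root_5_delta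

/-! ## §2 The field `F` and the order `𝓞_F = ℤ ⊕ ℤθ ⊕ ℤδ` -/

section NumberField

variable {F : Type*} [Field F] [NumberField F] {α : F}

omit [NumberField F] in
/-- The cubic relation `f(α) = 0` in `F`. [cite: LMFDB, number field 3.1.2071.1 (defining polynomial)] -/
theorem cubic_eq (hα : aeval α (poly (-5) (-6) (-8)) = 0) : α ^ 3 - 5 * α ^ 2 - 6 * α - 8 = 0 := by
  have h := hα
  simp only [poly, map_add, map_mul, map_pow, aeval_X, eq_intCast, map_intCast] at h
  push_cast at h
  linear_combination h

/-- **`δ = (α ^ 2 + α) / 2` is a root of `g`.** [cite: Marcus2018, Ch. 2, Exercise 27] -/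
theorem delta_root (hα : aeval α (poly (-5) (-6) (-8)) = 0) : aeval ((α ^ 2 + α) / 2) (poly (-21) (-26) (-8)) = 0 := by
  simp only [poly, map_add, map_mul, map_pow, aeval_X, eq_intCast, map_intCast]
  push_cast
  linear_combination (((1 : F)) + ((7 : F) / 8) * α + ((1 : F)) * α ^ 2 + ((1 : F) / 8) * α ^ 3) * cubic_eq hα

/-- **`2 x ∈ ℤ[θ]` for every algebraic integer `x`** (`Δ(f) = 2²·(−2071)`, `−2071` squarefree, so `indexDet ∣ 2`). [cite: Marcus2018, Ch. 2, Exercise 27(c)] -/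
theorem mem2 (h3 : finrank ℚ F = 3) (hα : aeval α (poly (-5) (-6) (-8)) = 0) (x : 𝓞 F) :
    ((2 : ℕ) : F) * x ∈ Algebra.adjoin ℤ ({α} : Set F) := by
  have h := mul_mem_adjoin_of_discr_eq_sq_mul (pb irreducible_polyQ hα h3) (isIntegral_pb_gen irreducible_polyQ hα h3) 2 (-2071)
    (by rw [discr_pb, disc_eq]) squarefree_neg_2071 x
  rw [pb_gen] at h
  exact_mod_cast h

/-- **`2 x ∈ ℤ[δ]` for every algebraic integer `x`** (`Δ(g) = 2²·(−2071)`). [cite: Marcus2018, Ch. 2, Exercise 27(c)] -/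
theorem mem2_delta (h3 : finrank ℚ F = 3) (hα : aeval α (poly (-5) (-6) (-8)) = 0) (x : 𝓞 F) :
    ((2 : ℕ) : F) * x ∈ Algebra.adjoin ℤ ({(α ^ 2 + α) / 2} : Set F) := by
  have h := mul_mem_adjoin_of_discr_eq_sq_mul (pb irreducible_polyQ_delta (delta_root hα) h3)
    (isIntegral_pb_gen irreducible_polyQ_delta (delta_root hα) h3) 2 (-2071)
    (by rw [discr_pb, disc_delta_eq]) squarefree_neg_2071 x
  rw [pb_gen] at h
  exact_mod_cast h

/-- `p ∤ exponent(θ)` for every prime `p ≠ 2` (Dedekind–Kummer for `f` away from `2`). [cite: Marcus2018, Ch. 3, Thm. 27] -/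
theorem not_dvd_exponent (h3 : finrank ℚ F = 3) (hα : aeval α (poly (-5) (-6) (-8)) = 0) {p : ℕ} (hp : p.Prime) (hp2 : p ≠ 2) :
    ¬ p ∣ RingOfIntegers.exponent (thetaInt hα) :=
  MonicCubic.not_dvd_exponent hα (mem2 h3 hα) fun h =>
    hp2 ((Nat.prime_dvd_prime_iff_eq hp (by norm_num : Nat.Prime 2)).mp h)

/-- `p ∤ exponent(δ)` for every prime `p ≠ 2` (Dedekind–Kummer for `g` at `2`). [cite: Marcus2018, Ch. 3, Thm. 27] -/
theorem not_dvd_exponent_delta (h3 : finrank ℚ F = 3) (hα : aeval α (poly (-5) (-6) (-8)) = 0) {p : ℕ} (hp : p.Prime) (hp2 : p ≠ 2) :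
    ¬ p ∣ RingOfIntegers.exponent (thetaInt (delta_root hα)) :=
  MonicCubic.not_dvd_exponent (delta_root hα) (mem2_delta h3 hα) fun h =>
    hp2 ((Nat.prime_dvd_prime_iff_eq hp Nat.prime_two).mp h)

/-- **`2δ = θ² + 1θ`** in `𝓞 F`. [cite: Marcus2018, Ch. 2, Exercise 27] -/
theorem den_delta (hα : aeval α (poly (-5) (-6) (-8)) = 0) :
    2 * thetaInt (delta_root hα) = thetaInt hα ^ 2 + 1 * thetaInt hα := by
  rw [RingOfIntegers.ext_iff]
  simp only [map_mul, map_add, map_pow, map_ofNat, map_one, MonicCubic.thetaInt, RingOfIntegers.map_mk]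
  ring

/-- **The multiplication table of `ℤ ⊕ ℤθ ⊕ ℤδ`**: `θ² = -θ + 2 * δ`, `θδ = 4 + 6 * δ`, `δ² = 14 + 2 * θ + 21 * δ` (with `θ`, `δ` for the two generators) — so
`ℤ[θ, δ] = ℤ ⊕ ℤθ ⊕ ℤδ` (`= 𝓞_F`, index `2` over `ℤ[θ]`, `2` over `ℤ[δ]`). [cite: Marcus2018, Ch. 2, Exercise 27] -/
theorem mul_table (hα : aeval α (poly (-5) (-6) (-8)) = 0) :
    thetaInt hα ^ 2 = -thetaInt hα + 2 * thetaInt (delta_root hα) ∧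
    thetaInt hα * thetaInt (delta_root hα) = 4 + 6 * thetaInt (delta_root hα) ∧
    thetaInt (delta_root hα) ^ 2 = 14 + 2 * thetaInt hα + 21 * thetaInt (delta_root hα) := by
  refine ⟨?_, ?_, ?_⟩
  · rw [RingOfIntegers.ext_iff]
    simp only [map_mul, map_add, map_neg, map_pow, map_ofNat, MonicCubic.thetaInt, RingOfIntegers.map_mk]
    linear_combination (0 : F) * cubic_eq hα
  · rw [RingOfIntegers.ext_iff]
    simp only [map_mul, map_add, map_ofNat, MonicCubic.thetaInt, RingOfIntegers.map_mk]
    linear_combination (((1 : F) / 2)) * cubic_eq hα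
  · rw [RingOfIntegers.ext_iff]
    simp only [map_mul, map_add, map_pow, map_ofNat, MonicCubic.thetaInt, RingOfIntegers.map_mk]
    linear_combination (((7 : F) / 4) + ((1 : F) / 4) * α) * cubic_eq hα

/-- ★ **`d_F = −2071`.**  `Δ(f) = 2²·(−2071)` with `−2071` squarefree, and `δ` is HALF-integral on `1, θ, θ²` (`2δ = θ² + 1θ`), so the index of `ℤ[θ]` in `𝓞_F` is
EXACTLY `2` (`MonicCubic.discr_eq_of_disc_eq_four_mul`): `2` is a common index divisor (Dedekind), no generator has odd index. [cite: LMFDB, number field 3.1.2071.1 (discriminant −2071)]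
[cite: Marcus2018, Ch. 2, Exercise 27(c)–(e)] -/
theorem discr_eq (h3 : finrank ℚ F = 3) (hα : aeval α (poly (-5) (-6) (-8)) = 0) : discr F = -2071 :=
  discr_eq_of_disc_eq_four_mul irreducible_polyQ hα h3 disc_eq squarefree_neg_2071 (thetaInt (delta_root hα)) 0 1 1
    (by rw [coe_thetaInt]; push_cast; ring) (by norm_num)

/-- **`F` has exactly one complex place** (`r₂ = 1`): `d_F < 0` has sign `(−1)^{r₂}`, and `r₁ + 2r₂ = 3`. [cite: LMFDB, number field 3.1.2071.1 (signature [1,1])] -/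
theorem nrComplexPlaces_eq_one (h3 : finrank ℚ F = 3) (hα : aeval α (poly (-5) (-6) (-8)) = 0) : nrComplexPlaces F = 1 := by
  have hsum := card_add_two_mul_card_eq_rank F
  rw [h3] at hsum
  have hsign := NumberField.sign_discr F
  rw [discr_eq h3 hα] at hsign
  have hle : nrComplexPlaces F ≤ 1 := by omega
  rcases Nat.le_one_iff_eq_zero_or_eq_one.mp hle with h0 | h1
  · rw [h0, pow_zero, show (-2071 : ℤ).sign = -1 from rfl] at hsign
    norm_num at hsign
  · exact h1

end NumberField

end Literature.NumberTheory.CubicFields.CubicDisc2071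

end
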